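import Summits.CriticalPhenomena.PercolationContinuityZ3.Theorems.PercNearOneGluingNoHeavyPcintMemUniformExtrapolate
import Summits.CriticalPhenomena.PercolationContinuityZ3.Theorems.PercNearOneGluingNoHeavyPcintMemUniformTen
import Summits.CriticalPhenomena.PercolationContinuityZ3.Theorems.PercNearOneGluingNoHeavyPcintMemUniformTenNumWeightsA
import HarnessLib

/-!
# CriticalPhenomena/PercolationContinuityZ3 — Theorems/PercNearOneGluingNoHeavyPcintMemUniformTenZ5.lean: `μ_10(ℤ⁵)` from the dimension-6 list — the uniform memory-10 certificate extended DOWN to `d = 5` (polynomial extrapolation)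

Lane prim-pcint, STRUCTURE rule (prim-pcint-2 GEN 19).  By …MemUniformExtrapolate the 6192-row dimension-6 list `u10tab` (…MemUniformTenStruct) also
counts the memory-10 words of `ℤ⁵`: `memCount 5 10 n = cnt (uistepK 5 (rowsOf perm6 u10tab) 5) 0 n` (the 6192 classes are complete in dimension
`5 = τ/2`, STRUCTURE P20/N9), with row sums `base − fresh`.  Hence:
* **`memGrowth_ten_zd5_bounds`**: `88601588343/10¹⁰ ≤ μ_10(ℤ⁵) ≤ 88601588344/10¹⁰` (numeral certificate `UNumRowsLowB` with the landed weights `uV10_5`,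
  six 1032-row ranges by `decide +kernel`), i.e. `μ_10(ℤ⁵) = 8.8601588343…`;
* **`memGrowth_ten_ge/le_uniform_five`**: the K = 9 polynomial brackets of …MemUniformTen hold at `d = 5` too (the certificate `UPolyAllC … 9 5` is valid
  from `5`), so `memGrowth_ten_bounds_peval_of_five_le` holds for every `d ≥ 5`.

HONEST FRAMING: kernel evaluation + the extrapolation bookkeeping; nothing here is used by a certified `p_c` cell.  No `sorry`; standard axioms.
Written by prim-pcint-2 gen 19 (prover-prim-pcint-2-g19-0), 2026-08-26.
-/

noncomputable section

namespace Summit.CriticalPhenomena.PercolationContinuityZ3.Theorems.Pcint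

open Literature.Probability.Percolation Literature.Probability.LatticeModels PolyCert

variable (P : List (Equiv.Perm (Fin 6))) (T : List (List (List ℕ × List ℕ)))

/-! ### Numeral certificates at `d = 5` (row sums `base − fresh`, written without subtraction) -/

/-- The numeral check of the rows `lo … lo+cnt−1` in dimension `5`: `numLo·v_i + den·fresh_i ≤ den·base_i ≤ numHi·v_i + den·fresh_i`. [folklore] -/
def UNumRowsLowB (VT : List (List ℕ)) (numHi numLo den lo cnt : ℕ) : Bool :=
  (List.range' lo cnt).all fun i => decide (0 < vgetC VT i ∧
    den * baseSumNC P T VT i ≤ numHi * vgetC VT i + den * freshSumNC P T VT i ∧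
      numLo * vgetC VT i + den * freshSumNC P T VT i ≤ den * baseSumNC P T VT i)

/-- The corresponding `Prop` on the rows `lo ≤ i < hi`. [folklore] -/
def UNumRowsLow (VT : List (List ℕ)) (numHi numLo den lo hi : ℕ) : Prop :=
  ∀ i < hi, lo ≤ i → 0 < vgetC VT i ∧
    den * baseSumNC P T VT i ≤ numHi * vgetC VT i + den * freshSumNC P T VT i ∧
      numLo * vgetC VT i + den * freshSumNC P T VT i ≤ den * baseSumNC P T VT i

/-- Soundness of the `Bool` range form. [folklore] -/
theorem unumRowsLow_of_B {VT : List (List ℕ)} {numHi numLo den lo cnt : ℕ}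
    (h : UNumRowsLowB P T VT numHi numLo den lo cnt = true) : UNumRowsLow P T VT numHi numLo den lo (lo + cnt) := by
  intro i hi hlo
  have := List.all_eq_true.1 h i (List.mem_range'_1.2 ⟨hlo, hi⟩)
  simpa using this

/-- Ranges concatenate. [folklore] -/
theorem unumRowsLow_append {VT : List (List ℕ)} {numHi numLo den lo mid hi : ℕ}
    (h1 : UNumRowsLow P T VT numHi numLo den lo mid) (h2 : UNumRowsLow P T VT numHi numLo den mid hi) :
    UNumRowsLow P T VT numHi numLo den lo hi :=
  fun i hi' hlo => if him : i < mid then h1 i him hlo else h2 i hi' (Nat.le_of_not_lt him)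

/-- The chunked natural row sums are the real row sums of …GenBounds on `rowsOf T` (weights `vgetC VT`). [folklore] -/
theorem baseSumK_rowsOf_eq (hT : ChunksOK T = true) (VT : List (List ℕ)) (i : ℕ) :
    baseSumK (k := 5) (rowsOf P T) (fun j => (vgetC VT j : ℝ)) i = (baseSumNC P T VT i : ℝ) ∧
      freshSumK (k := 5) (rowsOf P T) (fun j => (vgetC VT j : ℝ)) i = (freshSumNC P T VT i : ℝ) := by
  constructor
  · unfold baseSumK baseSumNC
    push_cast
    exact Finset.sum_congr rfl fun a _ => by rw [sistep_rowsOf P T hT, cast_optVal]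
  · unfold freshSumK freshSumNC
    push_cast
    exact Finset.sum_congr rfl fun b _ => by rw [sistep_rowsOf P T hT, cast_optVal]

/-- **Two-sided bound at `d = 5` from a low numeral certificate** on a structurally valid dimension-6 list. [cite: PonitzTittmann2000, §3] -/
theorem memGrowth_mem_Icc_of_unumLow {τ N : ℕ} (hτ : 2 ≤ τ) (hT : ChunksOK T = true) (hN : (rowsOf P T).length = N)
    (hU : UStructK (k := 5) τ (rowsOf P T)) (hS : USuppK (k := 5) (rowsOf P T)) {VT : List (List ℕ)}
    {numHi numLo den : ℕ} (hden : 0 < den) (hlo : 0 < numLo) (h : UNumRowsLow P T VT numHi numLo den 0 N) :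
    (numLo : ℝ) / den ≤ MemoryTail.memGrowth 5 τ ∧ MemoryTail.memGrowth 5 τ ≤ (numHi : ℝ) / den := by
  set w : ℕ → ℝ := fun j => (vgetC VT j : ℝ) with hw
  have hdenR : (0 : ℝ) < den := by exact_mod_cast hden
  have hrow : ∀ i < (rowsOf P T).length,
      0 < w i ∧ (numLo : ℝ) * w i ≤ (den : ℝ) * (baseSumK (k := 5) (rowsOf P T) w i - freshSumK (k := 5) (rowsOf P T) w i) ∧
        (den : ℝ) * (baseSumK (k := 5) (rowsOf P T) w i - freshSumK (k := 5) (rowsOf P T) w i) ≤ (numHi : ℝ) * w i := by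
    intro i hi
    rw [hN] at hi
    obtain ⟨h0, h1, h2⟩ := h i hi (Nat.zero_le i)
    obtain ⟨hb, hf⟩ := baseSumK_rowsOf_eq P T hT VT i
    rw [hw, hb, hf]
    refine ⟨by show (0:ℝ) < (vgetC VT i : ℝ); exact_mod_cast h0, ?_, ?_⟩
    · have := (Nat.cast_le (α := ℝ)).2 h2; push_cast at this; linarith
    · have := (Nat.cast_le (α := ℝ)).2 h1; push_cast at this; linarith
  have hloR : (0 : ℝ) < numLo := by exact_mod_cast hlo
  have hhiR : (0 : ℝ) < numHi := by
    obtain ⟨hw0, h1, h2⟩ := hrow 0 hU.1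
    have : (0 : ℝ) < (numHi : ℝ) * w 0 := by nlinarith
    by_contra hc
    push Not at hc
    nlinarith
  constructor
  · refine le_memGrowth_of_ucertK_low (k := 5) hτ hU hS w _ (div_pos hloR hdenR) (fun i hi => (hrow i hi).1) fun i hi => ?_
    have := (hrow i hi).2.1
    rw [div_mul_eq_mul_div, div_le_iff₀ hdenR]
    linarith
  · refine memGrowth_le_of_ucertK_low (k := 5) hτ hU hS w _ (div_pos hhiR hdenR) (fun i hi => (hrow i hi).1) fun i hi => ?_
    have := (hrow i hi).2.2
    rw [div_mul_eq_mul_div, le_div_iff₀ hdenR]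
    linarith

/-! ### `μ_10(ℤ⁵)` -/

/-- Chunk discipline of `uV10_5`. [folklore] -/
theorem chunksOK_uV10_5 : ChunksOK uV10_5 = true := by
  decide +kernel

/-- Low numeral certificate in dimension 5, rows 0–1031. [folklore] -/
theorem unumLow10_d5_0 : UNumRowsLowB perm6 u10tab uV10_5 88601588344 88601588343 10000000000 0 1032 = true := by
  decide +kernel

/-- Low numeral certificate in dimension 5, rows 1032–2063. [folklore] -/
theorem unumLow10_d5_1032 : UNumRowsLowB perm6 u10tab uV10_5 88601588344 88601588343 10000000000 1032 1032 = true := by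
  decide +kernel

/-- Low numeral certificate in dimension 5, rows 2064–3095. [folklore] -/
theorem unumLow10_d5_2064 : UNumRowsLowB perm6 u10tab uV10_5 88601588344 88601588343 10000000000 2064 1032 = true := by
  decide +kernel

/-- Low numeral certificate in dimension 5, rows 3096–4127. [folklore] -/
theorem unumLow10_d5_3096 : UNumRowsLowB perm6 u10tab uV10_5 88601588344 88601588343 10000000000 3096 1032 = true := by
  decide +kernel

/-- Low numeral certificate in dimension 5, rows 4128–5159. [folklore] -/
theorem unumLow10_d5_4128 : UNumRowsLowB perm6 u10tab uV10_5 88601588344 88601588343 10000000000 4128 1032 = true := by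
  decide +kernel

/-- Low numeral certificate in dimension 5, rows 5160–6191. [folklore] -/
theorem unumLow10_d5_5160 : UNumRowsLowB perm6 u10tab uV10_5 88601588344 88601588343 10000000000 5160 1032 = true := by
  decide +kernel

/-- **`88601588343/10¹⁰ ≤ μ_10(ℤ⁵) ≤ 88601588344/10¹⁰`**, i.e. `μ_10(ℤ⁵) = 8.8601588343…` — from the dimension-6 list, read in dimension 5 by polynomial
extrapolation. [cite: PonitzTittmann2000, §3] -/
theorem memGrowth_ten_zd5_bounds :
    (88601588343 : ℝ) / 10000000000 ≤ MemoryTail.memGrowth 5 10 ∧ MemoryTail.memGrowth 5 10 ≤ (88601588344 : ℝ) / 10000000000 :=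
  memGrowth_mem_Icc_of_unumLow perm6 u10tab (by norm_num) chunksOK_u10 length_u10 ustruct_u10 usupp_u10 (by norm_num) (by norm_num)
    (unumRowsLow_append perm6 u10tab (unumRowsLow_append perm6 u10tab (unumRowsLow_append perm6 u10tab (unumRowsLow_append perm6 u10tab (unumRowsLow_append perm6 u10tab (unumRowsLow_of_B perm6 u10tab unumLow10_d5_0) (unumRowsLow_of_B perm6 u10tab unumLow10_d5_1032)) (unumRowsLow_of_B perm6 u10tab unumLow10_d5_2064)) (unumRowsLow_of_B perm6 u10tab unumLow10_d5_3096)) (unumRowsLow_of_B perm6 u10tab unumLow10_d5_4128)) (unumRowsLow_of_B perm6 u10tab unumLow10_d5_5160))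

/-! ### The polynomial brackets at `d = 5` -/

/-- The row inequalities of the landed K = 9 certificate, in real form, for any reading dimension `d ≥ 5` (generic `d`; the proof of
`memGrowth_bounds_of_upolyC` up to the Collatz–Wielandt step). [folklore] -/
theorem upolyAll_u10_rows_real (d : ℕ) (hx : ((5 : ℤ) : ℝ) ≤ d) :
    ∀ i < (rowsOf perm6 u10tab).length,
      0 < peval (wgetC w10tab i) d ∧
      baseSumK (k := 5) (rowsOf perm6 u10tab) (fun j => peval (wgetC w10tab j) d) i +
          ((d : ℝ) - (5 + 1)) * freshSumK (k := 5) (rowsOf perm6 u10tab) (fun j => peval (wgetC w10tab j) d) i ≤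
        peval num10Hi d / (2 * (d : ℝ)) ^ 9 * peval (wgetC w10tab i) d ∧
      peval num10Lo d / (2 * (d : ℝ)) ^ 9 * peval (wgetC w10tab i) d ≤
        baseSumK (k := 5) (rowsOf perm6 u10tab) (fun j => peval (wgetC w10tab j) d) i +
          ((d : ℝ) - (5 + 1)) * freshSumK (k := 5) (rowsOf perm6 u10tab) (fun j => peval (wgetC w10tab j) d) i := by
  set w : ℕ → ℝ := fun j => peval (wgetC w10tab j) d with hw
  have hd0 : (0 : ℝ) < d := by push_cast at hx; linarith
  have hpowpos : (0 : ℝ) < (2 * (d : ℝ)) ^ 9 := by positivity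
  intro i hi
  rw [length_u10] at hi
  have h := upolyAll_u10 i hi (Nat.zero_le i)
  simp only [UPolyRowC, Bool.and_eq_true] at h
  have hHi := peval_nonneg_of_shift h.1.1 hx
  have hLo := peval_nonneg_of_shift h.1.2 hx
  have hwi : 0 < w i := peval_pos_of_shift h.2 hx
  have hrowval : peval (rowPolyC perm6 u10tab w10tab i) d =
      baseSumK (k := 5) (rowsOf perm6 u10tab) w i + ((d : ℝ) - (5 + 1)) * freshSumK (k := 5) (rowsOf perm6 u10tab) w i := by
    rw [peval_rowPolyC perm6 u10tab chunksOK_u10, hw]; norm_num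
  rw [resHiC, peval_padd, peval_pmul, peval_psmul, peval_pmul, peval_ppow, peval_twoX, hrowval] at hHi
  rw [resLoC, peval_padd, peval_pmul, peval_psmul, peval_pmul, peval_ppow, peval_twoX, hrowval] at hLo
  push_cast at hHi hLo
  refine ⟨hwi, ?_, ?_⟩
  · rw [div_mul_eq_mul_div, le_div_iff₀ hpowpos]
    show _ * _ ≤ peval num10Hi ↑d * w i
    nlinarith
  · rw [div_mul_eq_mul_div, div_le_iff₀ hpowpos]
    show peval num10Lo ↑d * w i ≤ _ * _
    nlinarith

/-- **The K = 9 polynomial brackets of `μ_10` hold at `d = 5` as well** (certificate valid from `5`; transfer by extrapolation). [cite: PonitzTittmann2000, §3] -/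
theorem memGrowth_ten_bounds_peval_five :
    peval num10Lo (5 : ℕ) / (2 * ((5 : ℕ) : ℝ)) ^ 9 ≤ MemoryTail.memGrowth 5 10 ∧
      MemoryTail.memGrowth 5 10 ≤ peval num10Hi (5 : ℕ) / (2 * ((5 : ℕ) : ℝ)) ^ 9 := by
  have hx : ((5 : ℤ) : ℝ) ≤ ((5 : ℕ) : ℝ) := by norm_num
  have hrows := upolyAll_u10_rows_real 5 hx
  have h0 : 0 < (rowsOf perm6 u10tab).length := ustruct_u10.1
  have hpowpos : (0 : ℝ) < (2 * ((5 : ℕ) : ℝ)) ^ 9 := by positivity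
  have hlo : 0 < peval num10Lo ((5 : ℕ) : ℝ) := num10Lo_pos (by norm_num)
  have e5 : (((5 : ℕ) : ℝ) - (5 + 1)) = -1 := by norm_num
  have hwpos : ∀ i < (rowsOf perm6 u10tab).length, 0 < peval (wgetC w10tab i) ((5 : ℕ) : ℝ) := fun i hi => (hrows i hi).1
  have hhi' : ∀ i < (rowsOf perm6 u10tab).length,
      baseSumK (k := 5) (rowsOf perm6 u10tab) (fun j => peval (wgetC w10tab j) ((5 : ℕ) : ℝ)) i -
          freshSumK (k := 5) (rowsOf perm6 u10tab) (fun j => peval (wgetC w10tab j) ((5 : ℕ) : ℝ)) i ≤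
        peval num10Hi ((5 : ℕ) : ℝ) / (2 * ((5 : ℕ) : ℝ)) ^ 9 * peval (wgetC w10tab i) ((5 : ℕ) : ℝ) := by
    intro i hi; have := (hrows i hi).2.1; rw [e5] at this; linarith
  have hlo' : ∀ i < (rowsOf perm6 u10tab).length,
      peval num10Lo ((5 : ℕ) : ℝ) / (2 * ((5 : ℕ) : ℝ)) ^ 9 * peval (wgetC w10tab i) ((5 : ℕ) : ℝ) ≤
        baseSumK (k := 5) (rowsOf perm6 u10tab) (fun j => peval (wgetC w10tab j) ((5 : ℕ) : ℝ)) i -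
          freshSumK (k := 5) (rowsOf perm6 u10tab) (fun j => peval (wgetC w10tab j) ((5 : ℕ) : ℝ)) i := by
    intro i hi; have := (hrows i hi).2.2; rw [e5] at this; linarith
  have hhiPos : 0 < peval num10Hi ((5 : ℕ) : ℝ) := by
    have h1 := hhi' 0 h0
    have h2 := hlo' 0 h0
    have hw0 := hwpos 0 h0
    have : 0 < peval num10Lo ((5 : ℕ) : ℝ) / (2 * ((5 : ℕ) : ℝ)) ^ 9 * peval (wgetC w10tab 0) ((5 : ℕ) : ℝ) :=
      mul_pos (div_pos hlo hpowpos) hw0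
    have h3 : 0 < peval num10Hi ((5 : ℕ) : ℝ) / (2 * ((5 : ℕ) : ℝ)) ^ 9 * peval (wgetC w10tab 0) ((5 : ℕ) : ℝ) := by linarith
    have h4 : 0 < peval num10Hi ((5 : ℕ) : ℝ) / (2 * ((5 : ℕ) : ℝ)) ^ 9 := pos_of_mul_pos_left h3 hw0.le
    exact (div_pos_iff_of_pos_right hpowpos).1 h4
  exact ⟨le_memGrowth_of_ucertK_low (k := 5) (by norm_num) ustruct_u10 usupp_u10 _ _ (div_pos hlo hpowpos) hwpos hlo',
    memGrowth_le_of_ucertK_low (k := 5) (by norm_num) ustruct_u10 usupp_u10 _ _ (div_pos hhiPos hpowpos) hwpos hhi'⟩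

/-- **The uniform brackets of `μ_10(ℤ^d)` hold for every `d ≥ 5`.** [folklore] -/
theorem memGrowth_ten_bounds_peval_of_five_le {d : ℕ} (hd : 5 ≤ d) :
    peval num10Lo d / (2 * (d : ℝ)) ^ 9 ≤ MemoryTail.memGrowth d 10 ∧ MemoryTail.memGrowth d 10 ≤ peval num10Hi d / (2 * (d : ℝ)) ^ 9 := by
  rcases Nat.lt_or_ge d 6 with h | h
  · have : d = 5 := by omega
    subst this
    exact memGrowth_ten_bounds_peval_five
  · exact memGrowth_ten_bounds_peval h

end Summit.CriticalPhenomena.PercolationContinuityZ3.Theorems.Pcint
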